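import Literature.NumberTheory.Automorphic.OpenCellSections
import Literature.NumberTheory.Automorphic.UnipotentRadicalCompactOpenProofs
import HarnessLib

/-!
# Twisted coinvariants of the open-cell part of `Ind_P^G σ'`

Topic `NumberTheory/Automorphic`. Continuation of `OpenCellSections`. Let `I_open ≤ Ind_{P_c}^G σ'`
be the `U_n`-stable subspace of functions vanishing off the open cell `P_c w₀ U_n`
(`vanishingOn (cellLT c w₀)`), with the `ψ_U⁻¹`-twisted action of `U_n` (`openCellSubrep`), and let
`J = (I_open)_{U_n, ψ}` be its coinvariants (`Representation.Coinvariants`), `[x]` the class of `x`.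
For the standard sections `Φ_{K,w}` of `OpenCellSections` we prove:

* `mk_smoothIndRep_apply` — `[u · x] = ψ_U(u) [x]`;
* `cellSection_eq_sum_smoothIndRep` — coset decomposition `Φ_{K,w} = ∑_{r ∈ R} r · Φ_{K_s,w}` for
  compact open subgroups `K_s ≤ K` of `N'` and a left transversal `R` of `K / K_s`
  (`IsLeftTransversal` of `CompactOpenAveraging`); hence `[Φ_{K,w}] = (∑_{r∈R} ψ_U(r)) [Φ_{K_s,w}]`,
  `= |R| [Φ_{K_s,w}]` when `ψ_U` is trivial on `K` (`mk_cellSection_eq_card_smul`) — the finite-sum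
  substitute for `∫_K = [K : K_s] ∫_{K_s}`;
* `whittakerCharFun_smul_mk_cellSection` — **the relation from `A'`**:
  `ψ_U(m) • [Φ_{K₀,w}] = [Φ_{K₀, σ'(w₀ m w₀⁻¹) w}]` for `m ∈ A'` and `K₀ ⊆ Ker ψ_U` (choose a compact
  open `L ≥ K₀` inside `Ker ψ_U` normalised by `m`, `exists_subgroup_normalised`, and use
  `m · Φ_{L,w} = Φ_{m L m⁻¹, σ'(w₀ m w₀⁻¹) w}`);
* `mk_mem_span_range_mk_cellSection` — **the classes `[Φ_{K₀,w}]`, `w ∈ W`, span `J`**: every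
  `f ∈ I_open` is a finite sum `∑_r r⁻¹ · Φ_{r K' r⁻¹, f(w₀ r)}` (the support of `n' ↦ f(w₀ n')` on
  `N'` is compact by the support lemma of `ParabolicBruhatCellSupport` and `A' ∩ N' = 1`), and
  `[Φ_{K,w}] ∈ ℂ [Φ_{K₀,w}]` (`mk_cellSection_mem_span_singleton`).

So `w ↦ [Φ_{K₀,w}]` is a surjection `W ↠ J` factoring through
`W / ⟨σ'(w₀ m w₀⁻¹) w - ψ_U(m) w⟩`: the open-orbit term of Bernstein–Zelevinsky's geometric lemma
(1977, Thm. 5.2) as an upper bound, without Haar measure. Definitions with bodies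
(`openCellSubrep`, `radicalToUpper`); no named fact.

## References

* I. N. Bernstein, A. V. Zelevinsky, *Induced representations of reductive `p`-adic groups I*,
  Ann. Sci. ÉNS 10 (1977), Thm. 5.2. [BernsteinZelevinskyASENS1977]
* I. N. Bernstein, A. V. Zelevinsky, *Representations of the group GL(n, F) where F is a
  non-archimedean local field*, Russian Math. Surveys 31:3 (1976), §2.22–2.25. [BernsteinZelevinskyRMS1976]
-/

open scoped Pointwise BigOperators
open Matrix OrderDual Topology

namespace Literature.NumberTheory.Automorphic


section Span

variable {F : Type*} [Field F] [ValuativeRel F] [TopologicalSpace F] [IsNonarchimedeanLocalField F]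
  {n : ℕ} {α : Type*} [LinearOrder α] [Fintype α] {c : Fin n → α}
  {W : Type*} [AddCommGroup W] [Module ℂ W]
  (σ' : Representation ℂ ↥(standardParabolicGL F c) W) (ψ : AddChar F Circle)

/-! ### The open-cell subrepresentation of `ψ_U⁻¹ ⊗ Ind|_{U_n}` and its coinvariants -/

/-- **The open-cell part** `I_open` of `ψ_U⁻¹ ⊗ Ind_{P_c}^G σ'|_{U_n}`: functions vanishing on
`cellLT c w₀`, the closed complement of the open cell (a `U_n`-subrepresentation). [folklore] -/
noncomputable def openCellSubrep (c : Fin n → α) (σ' : Representation ℂ ↥(standardParabolicGL F c) W)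
    (ψ : AddChar F Circle) :
    Subrepresentation (whittakerTwist (Representation.smoothIndRep (standardParabolicGL F c) σ') ψ) where
  toSubmodule := vanishingOn (standardParabolicGL F c) σ' (cellLT (K := F) c Fin.revPerm)
  apply_mem_toSubmodule u _ hf :=
    whittakerTwist_apply_mem_vanishingOn c σ' ψ (fun _ hg u => mul_mem_cellsBelow c hg u) u hf

/-- The carrier of `openCellSubrep` is `vanishingOn (cellLT c w₀)`. [folklore] -/
@[simp] lemma openCellSubrep_toSubmodule :
    (openCellSubrep c σ' ψ).toSubmodule = vanishingOn (standardParabolicGL F c) σ' (cellLT (K := F) c Fin.revPerm) :=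
  rfl

/-- **The class of a translate**: in the coinvariants `J = (I_open)_{U_n,ψ}`,
`[u · x] = ψ_U(u) [x]`. [folklore] -/
theorem mk_smoothIndRep_apply (u : ↥(upperUnitriangular (Fin n) F))
    (x : ↥(openCellSubrep c σ' ψ).toSubmodule) :
    Representation.Coinvariants.mk (openCellSubrep c σ' ψ).toRepresentation
        ⟨Representation.smoothIndRep (standardParabolicGL F c) σ' (u : GL (Fin n) F) x,
          smoothIndRep_apply_mem_vanishingOn (fun _ hg => mul_mem_cellsBelow c hg u) x.2⟩ =
      (whittakerCharFun ψ u) • Representation.Coinvariants.mk (openCellSubrep c σ' ψ).toRepresentation x := by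
  have h := Representation.Coinvariants.mk_self_apply (openCellSubrep c σ' ψ).toRepresentation u x
  have hval : ((openCellSubrep c σ' ψ).toRepresentation u x : Representation.SmoothInd (standardParabolicGL F c) σ') =
      (whittakerCharFun ψ u)⁻¹ • Representation.smoothIndRep (standardParabolicGL F c) σ' (u : GL (Fin n) F) x := by
    change whittakerTwist (Representation.smoothIndRep (standardParabolicGL F c) σ') ψ u
      (x : Representation.SmoothInd (standardParabolicGL F c) σ') = _
    exact whittakerTwist_apply _ ψ u _
  have hx : (openCellSubrep c σ' ψ).toRepresentation u x =
      (whittakerCharFun ψ u)⁻¹ • ⟨Representation.smoothIndRep (standardParabolicGL F c) σ' (u : GL (Fin n) F) x,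
        smoothIndRep_apply_mem_vanishingOn (fun _ hg => mul_mem_cellsBelow c hg u) x.2⟩ :=
    Subtype.ext hval
  rw [hx, map_smul] at h
  have hne : whittakerCharFun ψ u ≠ 0 := whittakerCharFun_ne_zero ψ u
  calc _ = whittakerCharFun ψ u • ((whittakerCharFun ψ u)⁻¹ •
        Representation.Coinvariants.mk (openCellSubrep c σ' ψ).toRepresentation
          ⟨Representation.smoothIndRep (standardParabolicGL F c) σ' (u : GL (Fin n) F) x,
            smoothIndRep_apply_mem_vanishingOn (fun _ hg => mul_mem_cellsBelow c hg u) x.2⟩) := by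
          rw [smul_smul, mul_inv_cancel₀ hne, one_smul]
    _ = _ := by rw [h]

/-! ### The coset decomposition of a standard section -/

variable {σ'}

omit [ValuativeRel F] [TopologicalSpace F] [IsNonarchimedeanLocalField F] [Fintype α] in
open Classical in
/-- For a left transversal `R` of `K / K_s` and `n' ∈ N'`, the number of `r ∈ R` with `n' r ∈ K_s` is
`1` if `n' ∈ K` and `0` otherwise. [folklore] -/
lemma card_filter_mul_mem_eq {K Ks : Subgroup ↥(oppositeCellRadical (K := F) c)} (hKs : Ks ≤ K)
    {R : Finset ↥(oppositeCellRadical (K := F) c)} (hR : IsLeftTransversal K Ks R)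
    (x : ↥(oppositeCellRadical (K := F) c)) :
    (R.filter fun r => x * r ∈ Ks).card = if x ∈ K then 1 else 0 := by
  classical
  split_ifs with hx
  · rw [Finset.card_eq_one]
    obtain ⟨r, ⟨hrR, hr⟩, huniq⟩ := hR.existsUnique x⁻¹ (K.inv_mem hx)
    refine ⟨r, Finset.eq_singleton_iff_unique_mem.2 ⟨Finset.mem_filter.2 ⟨hrR, ?_⟩, fun r' hr' => ?_⟩⟩
    · have : x * r = (r⁻¹ * x⁻¹)⁻¹ := by group
      rw [this]
      exact Ks.inv_mem hr
    · obtain ⟨hr'R, hr'x⟩ := Finset.mem_filter.1 hr'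
      refine huniq r' ⟨hr'R, ?_⟩
      have : r'⁻¹ * x⁻¹ = (x * r')⁻¹ := by group
      rw [this]
      exact Ks.inv_mem hr'x
  · rw [Finset.card_eq_zero, Finset.filter_eq_empty_iff]
    intro r hrR hxr
    apply hx
    have : x = (x * r) * r⁻¹ := by group
    rw [this]
    exact K.mul_mem (hKs hxr) (K.inv_mem (hR.mem_of_mem r hrR))

/-- **Coset decomposition of a standard section**: for compact open subgroups `K_s ≤ K` of `N'` and a
left transversal `R` of `K / K_s`, `Φ_{K,w} = ∑_{r ∈ R} r · Φ_{K_s,w}` (as `1_K(n') = ∑_r 1_{K_s}(n' r)`).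
[folklore] -/
theorem cellSection_eq_sum_smoothIndRep (hc : Monotone c) (hσ' : σ'.IsSmooth)
    {K Ks : Subgroup ↥(oppositeCellRadical (K := F) c)} (hKs : Ks ≤ K)
    (hKo : IsOpen (K : Set ↥(oppositeCellRadical (K := F) c))) (hKc : IsCompact (K : Set ↥(oppositeCellRadical (K := F) c)))
    (hKso : IsOpen (Ks : Set ↥(oppositeCellRadical (K := F) c))) (hKsc : IsCompact (Ks : Set ↥(oppositeCellRadical (K := F) c)))
    {R : Finset ↥(oppositeCellRadical (K := F) c)} (hR : IsLeftTransversal K Ks R) (w : W) :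
    cellSection σ' hc hσ' K hKo hKc w =
      ∑ r ∈ R, Representation.smoothIndRep (standardParabolicGL F c) σ' ((r : ↥(oppositeCellRadical (K := F) c)) : GL (Fin n) F)
        (cellSection σ' hc hσ' Ks hKso hKsc w) := by
  classical
  apply Representation.SmoothInd.ext
  funext g
  rw [Representation.SmoothInd.toFun_sum, toFun_cellSection]
  by_cases hg : g ∈ parabolicDoubleCoset (K := F) c Fin.revPerm
  · obtain ⟨p, hp, n', hn', rfl⟩ := (mem_parabolicDoubleCoset_rev_iff c hc g).1 hg
    have hterm : ∀ r ∈ R, (Representation.smoothIndRep (standardParabolicGL F c) σ'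
        ((r : ↥(oppositeCellRadical (K := F) c)) : GL (Fin n) F) (cellSection σ' hc hσ' Ks hKso hKsc w)).toFun
          (p * permGL Fin.revPerm * n') =
        if (⟨n', hn'⟩ : ↥(oppositeCellRadical (K := F) c)) * r ∈ Ks then σ' ⟨p, hp⟩ w else 0 := by
      intro r _
      rw [toFun_smoothIndRep_radical_cellSection]
      have hmem : n' * (r : GL (Fin n) F) ∈ oppositeCellRadical (K := F) c := Subgroup.mul_mem _ hn' r.2
      have e : (⟨n' * (r : GL (Fin n) F), hmem⟩ : ↥(oppositeCellRadical (K := F) c)) = ⟨n', hn'⟩ * r := rfl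
      split_ifs with h
      · exact cellSectionFun_eq_of_mem hc w hp hmem (by rw [e]; exact h)
      · exact cellSectionFun_eq_zero_of_not_mem hc w hp hmem (by rw [e]; exact h)
    rw [Finset.sum_congr rfl hterm, Finset.sum_ite, Finset.sum_const_zero, add_zero, Finset.sum_const,
      card_filter_mul_mem_eq hKs hR]
    by_cases hK : (⟨n', hn'⟩ : ↥(oppositeCellRadical (K := F) c)) ∈ K
    · rw [cellSectionFun_eq_of_mem hc w hp hn' hK, if_pos hK, one_smul]
    · rw [cellSectionFun_eq_zero_of_not_mem hc w hp hn' hK, if_neg hK, zero_smul]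
  · rw [cellSectionFun_of_not_mem hc _ w hg]
    symm
    refine Finset.sum_eq_zero fun r _ => ?_
    rw [Representation.toFun_smoothIndRep_apply, toFun_cellSection]
    refine cellSectionFun_of_not_mem hc _ w fun h => hg ?_
    exact mem_parabolicDoubleCoset_rev_of_mul_mem h (oppositeCellRadical_le c hc r.2)

/-- **The classes of standard sections of nested subgroups**: in `J = (I_open)_{U_n,ψ}`,
`[Φ_{K,w}] = (∑_{r ∈ R} ψ_U(r)) • [Φ_{K_s,w}]`. [folklore] -/
theorem mk_cellSection_eq_sum_smul (hc : Monotone c) (hσ' : σ'.IsSmooth)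
    {K Ks : Subgroup ↥(oppositeCellRadical (K := F) c)} (hKs : Ks ≤ K)
    (hKo : IsOpen (K : Set ↥(oppositeCellRadical (K := F) c))) (hKc : IsCompact (K : Set ↥(oppositeCellRadical (K := F) c)))
    (hKso : IsOpen (Ks : Set ↥(oppositeCellRadical (K := F) c))) (hKsc : IsCompact (Ks : Set ↥(oppositeCellRadical (K := F) c)))
    {R : Finset ↥(oppositeCellRadical (K := F) c)} (hR : IsLeftTransversal K Ks R) (w : W) :
    Representation.Coinvariants.mk (openCellSubrep c σ' ψ).toRepresentation
        ⟨cellSection σ' hc hσ' K hKo hKc w, cellSection_mem_vanishingOn σ' hc hσ' K hKo hKc w⟩ =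
      (∑ r ∈ R, whittakerCharFun ψ ⟨(r : GL (Fin n) F), oppositeCellRadical_le c hc r.2⟩) •
        Representation.Coinvariants.mk (openCellSubrep c σ' ψ).toRepresentation
          ⟨cellSection σ' hc hσ' Ks hKso hKsc w, cellSection_mem_vanishingOn σ' hc hσ' Ks hKso hKsc w⟩ := by
  have hsum : (⟨cellSection σ' hc hσ' K hKo hKc w, cellSection_mem_vanishingOn σ' hc hσ' K hKo hKc w⟩ :
      ↥(openCellSubrep c σ' ψ).toSubmodule) =
      ∑ r ∈ R, ⟨Representation.smoothIndRep (standardParabolicGL F c) σ'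
          ((⟨(r : GL (Fin n) F), oppositeCellRadical_le c hc r.2⟩ : ↥(upperUnitriangular (Fin n) F)) : GL (Fin n) F)
          (⟨cellSection σ' hc hσ' Ks hKso hKsc w, cellSection_mem_vanishingOn σ' hc hσ' Ks hKso hKsc w⟩ :
            ↥(openCellSubrep c σ' ψ).toSubmodule),
        smoothIndRep_apply_mem_vanishingOn (fun _ hg => mul_mem_cellsBelow c hg _)
          (cellSection_mem_vanishingOn σ' hc hσ' Ks hKso hKsc w)⟩ := by
    apply Subtype.ext
    rw [Submodule.coe_sum]
    exact cellSection_eq_sum_smoothIndRep hc hσ' hKs hKo hKc hKso hKsc hR w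
  rw [hsum, map_sum, Finset.sum_smul]
  refine Finset.sum_congr rfl fun r _ => ?_
  exact mk_smoothIndRep_apply σ' ψ ⟨(r : GL (Fin n) F), oppositeCellRadical_le c hc r.2⟩ _

/-- If moreover `ψ_U` is trivial on `K`, then `[Φ_{K,w}] = |R| • [Φ_{K_s,w}]`. [folklore] -/
theorem mk_cellSection_eq_card_smul (hc : Monotone c) (hσ' : σ'.IsSmooth)
    {K Ks : Subgroup ↥(oppositeCellRadical (K := F) c)} (hKs : Ks ≤ K)
    (hKo : IsOpen (K : Set ↥(oppositeCellRadical (K := F) c))) (hKc : IsCompact (K : Set ↥(oppositeCellRadical (K := F) c)))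
    (hKso : IsOpen (Ks : Set ↥(oppositeCellRadical (K := F) c))) (hKsc : IsCompact (Ks : Set ↥(oppositeCellRadical (K := F) c)))
    {R : Finset ↥(oppositeCellRadical (K := F) c)} (hR : IsLeftTransversal K Ks R)
    (hKθ : ∀ x ∈ K, whittakerCharFun ψ ⟨(x : GL (Fin n) F), oppositeCellRadical_le c hc x.2⟩ = 1) (w : W) :
    Representation.Coinvariants.mk (openCellSubrep c σ' ψ).toRepresentation
        ⟨cellSection σ' hc hσ' K hKo hKc w, cellSection_mem_vanishingOn σ' hc hσ' K hKo hKc w⟩ =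
      (R.card : ℂ) • Representation.Coinvariants.mk (openCellSubrep c σ' ψ).toRepresentation
          ⟨cellSection σ' hc hσ' Ks hKso hKsc w, cellSection_mem_vanishingOn σ' hc hσ' Ks hKso hKsc w⟩ := by
  rw [mk_cellSection_eq_sum_smul ψ hc hσ' hKs hKo hKc hKso hKsc hR w,
    Finset.sum_congr rfl fun r hr => hKθ r (hR.mem_of_mem r hr), Finset.sum_const, nsmul_eq_mul, mul_one]

end Span


section Relations

variable {F : Type*} [Field F] [ValuativeRel F] [TopologicalSpace F] [IsNonarchimedeanLocalField F]
  {n : ℕ} {α : Type*} [LinearOrder α] [Fintype α] {c : Fin n → α}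
  {W : Type*} [AddCommGroup W] [Module ℂ W]
  {σ' : Representation ℂ ↥(standardParabolicGL F c) W} (ψ : AddChar F Circle)

/-- Standard sections only depend on the subgroup, not on the compactness/openness witnesses.
[folklore] -/
lemma cellSection_congr (hc : Monotone c) (hσ' : σ'.IsSmooth)
    {K K' : Subgroup ↥(oppositeCellRadical (K := F) c)} (h : K = K')
    (hKo : IsOpen (K : Set ↥(oppositeCellRadical (K := F) c))) (hKc : IsCompact (K : Set ↥(oppositeCellRadical (K := F) c)))
    (hKo' : IsOpen (K' : Set ↥(oppositeCellRadical (K := F) c))) (hKc' : IsCompact (K' : Set ↥(oppositeCellRadical (K := F) c)))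
    (w : W) : cellSection σ' hc hσ' K hKo hKc w = cellSection σ' hc hσ' K' hKo' hKc' w := by
  subst h
  rfl

/-- The inclusion `N' →* U_n`. [folklore] -/
noncomputable abbrev radicalToUpper (hc : Monotone c) :
    ↥(oppositeCellRadical (K := F) c) →* ↥(upperUnitriangular (Fin n) F) :=
  Subgroup.inclusion (oppositeCellRadical_le c hc)

omit [ValuativeRel F] [IsNonarchimedeanLocalField F] [Fintype α] in
/-- The inclusion `N' → U_n` is continuous. [folklore] -/
lemma continuous_radicalToUpper (hc : Monotone c) : Continuous (radicalToUpper (F := F) (c := c) hc) :=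
  Continuous.subtype_mk continuous_subtype_val _

omit [Fintype α] in
/-- `N'` is closed in `GL_n(F)`. [folklore] -/
lemma isClosed_oppositeCellRadical : IsClosed (oppositeCellRadical (K := F) c : Set (GL (Fin n) F)) := by
  haveI : T2Space F := (GaloisRepresentations.IsNonarchimedeanLocalField.isLocalField F).toT2Space
  exact isClosed_unipotentRadicalGL (R := F) (⇑toDual ∘ revLabel c)

omit [Fintype α] in
/-- The preimage in `N'` of a compact subset of `U_n` is compact. [folklore] -/
lemma isCompact_preimage_radicalToUpper (hc : Monotone c) {C : Set ↥(upperUnitriangular (Fin n) F)}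
    (hC : IsCompact C) : IsCompact ((radicalToUpper (F := F) (c := c) hc) ⁻¹' C) := by
  have h : ((radicalToUpper (F := F) (c := c) hc) ⁻¹' C) =
      (Subtype.val : ↥(oppositeCellRadical (K := F) c) → GL (Fin n) F) ⁻¹' (Subtype.val '' C) := by
    ext x
    simp only [Set.mem_preimage, Set.mem_image]
    constructor
    · intro hx
      exact ⟨_, hx, rfl⟩
    · rintro ⟨y, hy, hyx⟩
      have : y = radicalToUpper hc x := Subtype.ext hyx
      rw [← this]
      exact hy
  rw [h]
  exact (isClosed_oppositeCellRadical (c := c)).isClosedEmbedding_subtypeVal.isCompact_preimage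
    (hC.image continuous_subtype_val)

omit [Fintype α] in
/-- **A compact open subgroup of `N'` above `K₀`, inside `Ker ψ_U` and normalised by `m`.**
[folklore] -/
lemma exists_subgroup_normalised (hc : Monotone c) (hψ : Continuous ψ)
    (K₀ : Subgroup ↥(oppositeCellRadical (K := F) c)) (hK₀c : IsCompact (K₀ : Set ↥(oppositeCellRadical (K := F) c)))
    (hK₀θ : ∀ x ∈ K₀, whittakerCharFun ψ (radicalToUpper hc x) = 1)
    {m : GL (Fin n) F} (hm : m ∈ cellLeviUnipotent (K := F) c) :
    ∃ L : Subgroup ↥(oppositeCellRadical (K := F) c), K₀ ≤ L ∧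
      IsOpen (L : Set ↥(oppositeCellRadical (K := F) c)) ∧ IsCompact (L : Set ↥(oppositeCellRadical (K := F) c)) ∧
      (∀ x ∈ L, whittakerCharFun ψ (radicalToUpper hc x) = 1) ∧
      conjSubgroup (upperUnitriangular_le_reversedParabolic c hc (cellLeviUnipotent_le c hm)) L = L := by
  haveI : T2Space F := (GaloisRepresentations.IsNonarchimedeanLocalField.isLocalField F).toT2Space
  haveI : T2Space (GL (Fin n) F) := t2Space_generalLinearGroup F n
  set mU : ↥(upperUnitriangular (Fin n) F) := ⟨m, cellLeviUnipotent_le c hm⟩ with hmU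
  -- a compact open subgroup `U_j` of `U_n` containing `K₀` and `m`
  obtain ⟨Uj, hUjo, hUjc, hsub⟩ := isLimitOfCompactOpen_upperUnitriangular (F := F) (n := n) _
    ((hK₀c.image (continuous_radicalToUpper hc)).union (Set.finite_singleton mU).isCompact)
  refine ⟨(Uj ⊓ (whittakerChar (n := n) ψ).ker).comap (radicalToUpper hc), fun x hx => ?_, ?_, ?_, ?_, ?_⟩
  · exact ⟨hsub (Or.inl ⟨x, hx, rfl⟩), (mem_ker_whittakerChar_iff ψ _).2 (hK₀θ x hx)⟩
  · exact (hUjo.inter (isOpen_ker_whittakerChar hψ)).preimage (continuous_radicalToUpper hc)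
  · have h1 : IsCompact ((radicalToUpper (F := F) (c := c) hc) ⁻¹' (Uj : Set _)) :=
      isCompact_preimage_radicalToUpper hc hUjc
    refine h1.of_isClosed_subset ?_ fun x hx => hx.1
    exact ((hUjc.isClosed).inter ((whittakerChar (n := n) ψ).ker.isClosed_of_isOpen
      (isOpen_ker_whittakerChar hψ))).preimage (continuous_radicalToUpper hc)
  · intro x hx
    exact (mem_ker_whittakerChar_iff ψ _).1 hx.2
  · ext x
    rw [mem_conjSubgroup_iff]
    have hmUj : mU ∈ Uj := hsub (Or.inr rfl)
    simp only [Subgroup.mem_comap, Subgroup.mem_inf, MonoidHom.mem_ker]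
    have e : radicalToUpper hc ((radicalConj (upperUnitriangular_le_reversedParabolic c hc
        (cellLeviUnipotent_le c hm))).symm x) = mU⁻¹ * radicalToUpper hc x * mU := Subtype.ext rfl
    rw [e]
    constructor
    · rintro ⟨h1, h2⟩
      refine ⟨?_, ?_⟩
      · have := Uj.mul_mem (Uj.mul_mem hmUj h1) (Uj.inv_mem hmUj)
        simpa [mul_assoc] using this
      · rw [map_mul, map_mul, map_inv, mul_right_comm, inv_mul_cancel, one_mul] at h2
        exact h2
    · rintro ⟨h1, h2⟩
      exact ⟨Uj.mul_mem (Uj.mul_mem (Uj.inv_mem hmUj) h1) hmUj, by rw [map_mul, map_mul, map_inv, h2, mul_one, inv_mul_cancel]⟩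

/-- **The relation coming from `A'`**: for a compact open subgroup `K₀` of `N'` on which `ψ_U` is
trivial, `m ∈ A'` and `w ∈ W`, in `J = (I_open)_{U_n,ψ}` one has
`ψ_U(m) • [Φ_{K₀,w}] = [Φ_{K₀, σ'(w₀ m w₀⁻¹) w}]`. (Bernstein–Zelevinsky 1977, Thm. 5.2, open orbit.)
[cite: BernsteinZelevinskyASENS1977, Thm. 5.2] -/
theorem whittakerCharFun_smul_mk_cellSection (hc : Monotone c) (hσ' : σ'.IsSmooth) (hψ : Continuous ψ)
    (K₀ : Subgroup ↥(oppositeCellRadical (K := F) c)) (hK₀o : IsOpen (K₀ : Set ↥(oppositeCellRadical (K := F) c)))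
    (hK₀c : IsCompact (K₀ : Set ↥(oppositeCellRadical (K := F) c)))
    (hK₀θ : ∀ x ∈ K₀, whittakerCharFun ψ (radicalToUpper hc x) = 1)
    {m : GL (Fin n) F} (hm : m ∈ cellLeviUnipotent (K := F) c) (w : W) :
    whittakerCharFun ψ ⟨m, cellLeviUnipotent_le c hm⟩ •
        Representation.Coinvariants.mk (openCellSubrep c σ' ψ).toRepresentation
          ⟨cellSection σ' hc hσ' K₀ hK₀o hK₀c w, cellSection_mem_vanishingOn σ' hc hσ' K₀ hK₀o hK₀c w⟩ =
      Representation.Coinvariants.mk (openCellSubrep c σ' ψ).toRepresentation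
          ⟨cellSection σ' hc hσ' K₀ hK₀o hK₀c (σ' ⟨permGL Fin.revPerm * m * (permGL Fin.revPerm)⁻¹,
              conj_mem_standardParabolicGL_of_mem_cellLeviUnipotent c hm⟩ w),
            cellSection_mem_vanishingOn σ' hc hσ' K₀ hK₀o hK₀c _⟩ := by
  classical
  obtain ⟨L, hK₀L, hLo, hLc, hLθ, hLm⟩ := exists_subgroup_normalised ψ hc hψ K₀ hK₀c hK₀θ hm
  -- a transversal of `L / K₀`
  obtain ⟨R, hR⟩ := exists_isLeftTransversal (B := L) hLc hK₀o
  rw [inf_eq_right.2 hK₀L] at hR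
  have hcard : (R.card : ℂ) ≠ 0 := Nat.cast_ne_zero.2 (Finset.card_ne_zero.2 hR.nonempty)
  set w' : W := σ' ⟨permGL Fin.revPerm * m * (permGL Fin.revPerm)⁻¹,
    conj_mem_standardParabolicGL_of_mem_cellLeviUnipotent c hm⟩ w with hw'
  have hL1 := mk_cellSection_eq_card_smul (σ' := σ') ψ hc hσ' hK₀L hLo hLc hK₀o hK₀c hR hLθ w
  have hL2 := mk_cellSection_eq_card_smul (σ' := σ') ψ hc hσ' hK₀L hLo hLc hK₀o hK₀c hR hLθ w'
  -- `[m · Φ_{L,w}] = ψ_U(m) [Φ_{L,w}]` and `m · Φ_{L,w} = Φ_{L,w'}`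
  have hlevi := smoothIndRep_levi_cellSection σ' hc hσ' L hLo hLc w hm
  have hconj : cellSection σ' hc hσ' (conjSubgroup (upperUnitriangular_le_reversedParabolic c hc
      (cellLeviUnipotent_le c hm)) L) (isOpen_conjSubgroup _ hLo) (isCompact_conjSubgroup _ hLc) w' =
      cellSection σ' hc hσ' L hLo hLc w' := cellSection_congr hc hσ' hLm _ _ _ _ w'
  have hmk := mk_smoothIndRep_apply σ' ψ ⟨m, cellLeviUnipotent_le c hm⟩
    ⟨cellSection σ' hc hσ' L hLo hLc w, cellSection_mem_vanishingOn σ' hc hσ' L hLo hLc w⟩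
  have hmk' : Representation.Coinvariants.mk (openCellSubrep c σ' ψ).toRepresentation
      ⟨cellSection σ' hc hσ' L hLo hLc w', cellSection_mem_vanishingOn σ' hc hσ' L hLo hLc w'⟩ =
      whittakerCharFun ψ ⟨m, cellLeviUnipotent_le c hm⟩ •
        Representation.Coinvariants.mk (openCellSubrep c σ' ψ).toRepresentation
          ⟨cellSection σ' hc hσ' L hLo hLc w, cellSection_mem_vanishingOn σ' hc hσ' L hLo hLc w⟩ := by
    rw [← hmk]
    congr 1
    apply Subtype.ext
    change cellSection σ' hc hσ' L hLo hLc w' = Representation.smoothIndRep (standardParabolicGL F c) σ' m _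
    rw [hlevi, hconj]
  -- combine and cancel `|R|`
  rw [hL1, hL2, smul_comm (whittakerCharFun ψ _) (R.card : ℂ)] at hmk'
  exact (smul_right_injective _ hcard hmk').symm

end Relations


section Surjective

variable {F : Type*} [Field F] [ValuativeRel F] [TopologicalSpace F] [IsNonarchimedeanLocalField F]
  {n : ℕ} {α : Type*} [LinearOrder α] [Fintype α] {c : Fin n → α}
  {W : Type*} [AddCommGroup W] [Module ℂ W]
  {σ' : Representation ℂ ↥(standardParabolicGL F c) W} (ψ : AddChar F Circle)

/-- **Classes of standard sections are proportional**: for compact open subgroups `K`, `K₀` of `N'`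
with `ψ_U` trivial on `K₀`, `[Φ_{K,w}] ∈ ℂ • [Φ_{K₀,w}]` (compare both with `Φ_{K ∩ K₀, w}`).
[folklore] -/
theorem mk_cellSection_mem_span_singleton (hc : Monotone c) (hσ' : σ'.IsSmooth)
    (K₀ : Subgroup ↥(oppositeCellRadical (K := F) c)) (hK₀o : IsOpen (K₀ : Set ↥(oppositeCellRadical (K := F) c)))
    (hK₀c : IsCompact (K₀ : Set ↥(oppositeCellRadical (K := F) c)))
    (hK₀θ : ∀ x ∈ K₀, whittakerCharFun ψ (radicalToUpper hc x) = 1)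
    (K : Subgroup ↥(oppositeCellRadical (K := F) c)) (hKo : IsOpen (K : Set ↥(oppositeCellRadical (K := F) c)))
    (hKc : IsCompact (K : Set ↥(oppositeCellRadical (K := F) c))) (w : W) :
    Representation.Coinvariants.mk (openCellSubrep c σ' ψ).toRepresentation
        ⟨cellSection σ' hc hσ' K hKo hKc w, cellSection_mem_vanishingOn σ' hc hσ' K hKo hKc w⟩ ∈
      Submodule.span ℂ {Representation.Coinvariants.mk (openCellSubrep c σ' ψ).toRepresentation
        ⟨cellSection σ' hc hσ' K₀ hK₀o hK₀c w, cellSection_mem_vanishingOn σ' hc hσ' K₀ hK₀o hK₀c w⟩} := by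
  haveI : T2Space F := (GaloisRepresentations.IsNonarchimedeanLocalField.isLocalField F).toT2Space
  -- the common subgroup `K_s = K ⊓ K₀`
  have hKso : IsOpen ((K ⊓ K₀ : Subgroup ↥(oppositeCellRadical (K := F) c)) : Set ↥(oppositeCellRadical (K := F) c)) := by
    rw [Subgroup.coe_inf]
    exact hKo.inter hK₀o
  have hKsc : IsCompact ((K ⊓ K₀ : Subgroup ↥(oppositeCellRadical (K := F) c)) : Set ↥(oppositeCellRadical (K := F) c)) := by
    rw [Subgroup.coe_inf]
    exact hKc.inter_right (K₀.isClosed_of_isOpen hK₀o)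
  obtain ⟨R₁, hR₁⟩ := exists_isLeftTransversal (B := K₀) hK₀c hKo
  rw [inf_comm] at hR₁
  obtain ⟨R₂, hR₂⟩ := exists_isLeftTransversal (B := K) hKc hK₀o
  have h₁ := mk_cellSection_eq_card_smul (σ' := σ') ψ hc hσ' (inf_le_right : K ⊓ K₀ ≤ K₀) hK₀o hK₀c hKso hKsc hR₁
    hK₀θ w
  have h₂ := mk_cellSection_eq_sum_smul (σ' := σ') ψ hc hσ' (inf_le_left : K ⊓ K₀ ≤ K) hKo hKc hKso hKsc hR₂ w
  have hcard : (R₁.card : ℂ) ≠ 0 := Nat.cast_ne_zero.2 (Finset.card_ne_zero.2 hR₁.nonempty)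
  rw [Submodule.mem_span_singleton]
  refine ⟨(∑ r ∈ R₂, whittakerCharFun ψ ⟨(r : GL (Fin n) F), oppositeCellRadical_le c hc r.2⟩) * (R₁.card : ℂ)⁻¹, ?_⟩
  rw [h₂, h₁, smul_smul, mul_assoc, inv_mul_cancel₀ hcard, mul_one]

omit [Fintype α] in
/-- Values of `f ∈ Ind` are unchanged under right translation by the stabiliser. [folklore] -/
lemma toFun_w₀_mul_mul_of_mem_stabilizer {f : Representation.SmoothInd (standardParabolicGL F c) σ'}
    {k : GL (Fin n) F}
    (hk : k ∈ (Representation.smoothIndRep (standardParabolicGL F c) σ').stabilizerSubgroup f) (x : GL (Fin n) F) :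
    f.toFun (x * k) = f.toFun x := by
  have := congrArg (fun g : Representation.SmoothInd (standardParabolicGL F c) σ' => g.toFun x)
    ((Representation.mem_stabilizerSubgroup _ _ _).1 hk)
  simpa only [Representation.toFun_smoothIndRep_apply] using this

/-- **The classes of the standard sections span the coinvariants of the open-cell part**: for
`f ∈ I_open`, `[f] ∈ span {[Φ_{K₀,w}] : w ∈ W}`. (Bernstein–Zelevinsky 1977, Thm. 5.2, open orbit:
`F(τ)` is a quotient of `i ∘ w ∘ r (τ)`.) [cite: BernsteinZelevinskyASENS1977, Thm. 5.2] -/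
theorem mk_mem_span_range_mk_cellSection (hc : Monotone c) (hσ' : σ'.IsSmooth)
    (K₀ : Subgroup ↥(oppositeCellRadical (K := F) c)) (hK₀o : IsOpen (K₀ : Set ↥(oppositeCellRadical (K := F) c)))
    (hK₀c : IsCompact (K₀ : Set ↥(oppositeCellRadical (K := F) c)))
    (hK₀θ : ∀ x ∈ K₀, whittakerCharFun ψ (radicalToUpper hc x) = 1)
    (f : Representation.SmoothInd (standardParabolicGL F c) σ')
    (hf : f ∈ vanishingOn (standardParabolicGL F c) σ' (cellLT (K := F) c Fin.revPerm)) :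
    Representation.Coinvariants.mk (openCellSubrep c σ' ψ).toRepresentation ⟨f, hf⟩ ∈
      Submodule.span ℂ (Set.range fun w => Representation.Coinvariants.mk (openCellSubrep c σ' ψ).toRepresentation
        ⟨cellSection σ' hc hσ' K₀ hK₀o hK₀c w, cellSection_mem_vanishingOn σ' hc hσ' K₀ hK₀o hK₀c w⟩) := by
  classical
  haveI : T2Space F := (GaloisRepresentations.IsNonarchimedeanLocalField.isLocalField F).toT2Space
  -- Step 1: the support of `u ↦ f (w₀ u)` modulo `A'`
  have hPinv : ∀ p ∈ standardParabolicGL F c, ∀ g, f.toFun (p * g) ≠ 0 ↔ f.toFun g ≠ 0 := by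
    intro p hp g
    rw [show p * g = ((⟨p, hp⟩ : ↥(standardParabolicGL F c)) : GL (Fin n) F) * g from rfl,
      Representation.SmoothInd.toFun_subgroup_mul, not_iff_not]
    constructor
    · intro h
      have := congrArg (σ' (⟨p, hp⟩ : ↥(standardParabolicGL F c))⁻¹) h
      rwa [map_zero, ← Module.End.mul_apply, ← map_mul, inv_mul_cancel, map_one,
        Module.End.one_apply] at this
    · intro h
      rw [h, map_zero]
  obtain ⟨C, hC, hCsupp⟩ := exists_isCompact_support_of_eq_zero_on_cellLT (F := F) c hc Fin.revPerm f.toFun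
    (Representation.SmoothInd.isClosed_setOf_toFun_ne_zero f) hPinv hf
  -- Step 2: the support of `n' ↦ f (w₀ n')` on `N'` lies in the compact `C' = n(C)`
  have hsupp : ∀ x : ↥(oppositeCellRadical (K := F) c), f.toFun (permGL Fin.revPerm * (x : GL (Fin n) F)) ≠ 0 →
      (x : GL (Fin n) F) ∈ (cellRadicalPart (K := F) c hc) '' C := by
    intro x hx
    obtain ⟨v, hvC, ha⟩ := hCsupp ⟨x, oppositeCellRadical_le c hc x.2⟩ hx
    set a : ↥(upperUnitriangular (Fin n) F) := ⟨x, oppositeCellRadical_le c hc x.2⟩ * v⁻¹ with ha_def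
    have haA : (a : GL (Fin n) F) ∈ cellLeviUnipotent (K := F) c :=
      (mem_cellLeviUnipotent_iff_conj_mem c _).2 ⟨a.2, ha⟩
    refine ⟨v, hvC, ?_⟩
    have hv : v = ⟨(a : GL (Fin n) F)⁻¹ * x, Subgroup.mul_mem _ (Subgroup.inv_mem _ a.2)
        (oppositeCellRadical_le c hc x.2)⟩ := Subtype.ext (by
      have e : (a : GL (Fin n) F) = (x : GL (Fin n) F) * (v : GL (Fin n) F)⁻¹ := rfl
      show (v : GL (Fin n) F) = (a : GL (Fin n) F)⁻¹ * x
      rw [e]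
      group)
    rw [hv]
    exact cellRadicalPart_eq_of_mem c hc (Subgroup.inv_mem _ haA) x.2
  -- Step 3: a compact open subgroup `K' ≤ K₀` of `N'` fixing `f`
  obtain ⟨T, hT⟩ : ∃ T : Subgroup ↥(oppositeCellRadical (K := F) c), T =
      ((Representation.smoothIndRep (standardParabolicGL F c) σ').stabilizerSubgroup f).comap
        (oppositeCellRadical (K := F) c).subtype := ⟨_, rfl⟩
  have hTo : IsOpen (T : Set ↥(oppositeCellRadical (K := F) c)) := by
    rw [hT]
    exact (Representation.isSmooth_smoothInd (standardParabolicGL F c) σ' f).preimage continuous_subtype_val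
  obtain ⟨K', hK'⟩ : ∃ K' : Subgroup ↥(oppositeCellRadical (K := F) c), K' = K₀ ⊓ T := ⟨_, rfl⟩
  have hK'o : IsOpen (K' : Set ↥(oppositeCellRadical (K := F) c)) := by
    rw [hK', Subgroup.coe_inf]
    exact hK₀o.inter hTo
  have hK'c : IsCompact (K' : Set ↥(oppositeCellRadical (K := F) c)) := by
    rw [hK', Subgroup.coe_inf]
    exact hK₀c.inter_right (T.isClosed_of_isOpen hTo)
  have hK'stab : ∀ k ∈ K', ∀ x : GL (Fin n) F, f.toFun (x * (k : GL (Fin n) F)) = f.toFun x := by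
    intro k hk x
    rw [hK'] at hk
    have hkT := hk.2
    rw [hT] at hkT
    exact toFun_w₀_mul_mul_of_mem_stabilizer hkT x
  -- Step 4: a compact open subgroup `L'` of `N'` containing the support and `K'`
  have hC'' : IsCompact ((Subtype.val : ↥(oppositeCellRadical (K := F) c) → GL (Fin n) F) ⁻¹'
      ((cellRadicalPart (K := F) c hc) '' C)) :=
    (isClosed_oppositeCellRadical (c := c)).isClosedEmbedding_subtypeVal.isCompact_preimage
      (hC.image (continuous_cellRadicalPart c hc))
  have hlim : IsLimitOfCompactOpen ↥(oppositeCellRadical (K := F) c) :=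
    isLimitOfCompactOpen_unipotentRadicalGL F (⇑toDual ∘ revLabel c) (monotone_toDual_revLabel c hc)
  obtain ⟨L', hL'o, hL'c, hL'sub⟩ := hlim _ (hC''.union hK'c)
  have hK'L' : K' ≤ L' := fun x hx => hL'sub (Or.inr hx)
  have hsuppL' : ∀ x : ↥(oppositeCellRadical (K := F) c), f.toFun (permGL Fin.revPerm * (x : GL (Fin n) F)) ≠ 0 → x ∈ L' :=
    fun x hx => hL'sub (Or.inl (hsupp x hx))
  -- Step 5: a transversal of `L' / K'` and the decomposition of `f`
  obtain ⟨R, hR⟩ := exists_isLeftTransversal (B := L') hL'c hK'o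
  rw [inf_eq_right.2 hK'L'] at hR
  have hrP' : ∀ r : ↥(oppositeCellRadical (K := F) c), (r : GL (Fin n) F) ∈ standardParabolicGL F (⇑toDual ∘ revLabel c) :=
    fun r => oppositeCellRadical_le_reversedParabolic c r.2
  -- the summands
  set Φr : ↥(oppositeCellRadical (K := F) c) → Representation.SmoothInd (standardParabolicGL F c) σ' := fun r =>
    Representation.smoothIndRep (standardParabolicGL F c) σ' ((r : GL (Fin n) F))⁻¹
      (cellSection σ' hc hσ' (conjSubgroup (hrP' r) K') (isOpen_conjSubgroup _ hK'o) (isCompact_conjSubgroup _ hK'c)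
        (f.toFun (permGL Fin.revPerm * (r : GL (Fin n) F)))) with hΦr
  have hdecomp : f = ∑ r ∈ R, Φr r := by
    apply Representation.SmoothInd.ext
    funext g
    rw [Representation.SmoothInd.toFun_sum]
    by_cases hg : g ∈ parabolicDoubleCoset (K := F) c Fin.revPerm
    · obtain ⟨p, hp, n', hn', rfl⟩ := (mem_parabolicDoubleCoset_rev_iff c hc g).1 hg
      -- the terms
      have hterm : ∀ r ∈ R, (Φr r).toFun (p * permGL Fin.revPerm * n') =
          if r⁻¹ * ⟨n', hn'⟩ ∈ K' then σ' ⟨p, hp⟩ (f.toFun (permGL Fin.revPerm * (r : GL (Fin n) F))) else 0 := by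
        intro r _
        simp only [hΦr, Representation.toFun_smoothIndRep_apply, toFun_cellSection]
        have hmem : n' * ((r : GL (Fin n) F))⁻¹ ∈ oppositeCellRadical (K := F) c :=
          Subgroup.mul_mem _ hn' (Subgroup.inv_mem _ r.2)
        have e : p * permGL Fin.revPerm * n' * ((r : GL (Fin n) F))⁻¹ = p * permGL Fin.revPerm * (n' * ((r : GL (Fin n) F))⁻¹) := by
          group
        have hiff : (⟨n' * ((r : GL (Fin n) F))⁻¹, hmem⟩ : ↥(oppositeCellRadical (K := F) c)) ∈ conjSubgroup (hrP' r) K' ↔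
            r⁻¹ * ⟨n', hn'⟩ ∈ K' := by
          rw [mem_conjSubgroup_iff]
          have : (radicalConj (hrP' r)).symm ⟨n' * ((r : GL (Fin n) F))⁻¹, hmem⟩ = r⁻¹ * ⟨n', hn'⟩ :=
            Subtype.ext (by simp only [coe_radicalConj_symm, Subgroup.coe_mul, InvMemClass.coe_inv]; group)
          rw [this]
        rw [e]
        split_ifs with h
        · exact cellSectionFun_eq_of_mem hc _ hp hmem (hiff.2 h)
        · exact cellSectionFun_eq_zero_of_not_mem hc _ hp hmem (fun h' => h (hiff.1 h'))
      rw [Finset.sum_congr rfl hterm,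
        show f.toFun (p * permGL Fin.revPerm * n') = σ' ⟨p, hp⟩ (f.toFun (permGL Fin.revPerm * n')) by
          rw [mul_assoc]; exact Representation.SmoothInd.toFun_subgroup_mul f ⟨p, hp⟩ _]
      by_cases hL : (⟨n', hn'⟩ : ↥(oppositeCellRadical (K := F) c)) ∈ L'
      · -- exactly one term, `r₀`, and `f (w₀ n') = f (w₀ r₀)`
        obtain ⟨r₀, ⟨hr₀R, hr₀⟩, huniq⟩ := hR.existsUnique _ hL
        rw [Finset.sum_eq_single r₀]
        · rw [if_pos hr₀]
          congr 1
          have : permGL Fin.revPerm * n' = permGL Fin.revPerm * (r₀ : GL (Fin n) F) *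
              (((r₀⁻¹ * ⟨n', hn'⟩ : ↥(oppositeCellRadical (K := F) c))) : GL (Fin n) F) := by
            simp only [Subgroup.coe_mul, InvMemClass.coe_inv]
            group
          rw [this, hK'stab _ hr₀]
        · intro r hrR hne
          rw [if_neg]
          exact fun h => hne (huniq r ⟨hrR, h⟩)
        · intro h
          exact absurd hr₀R h
      · -- no term, and `f (w₀ n') = 0`
        have h0 : f.toFun (permGL Fin.revPerm * n') = 0 := by
          by_contra h
          exact hL (hsuppL' ⟨n', hn'⟩ h)
        rw [h0, map_zero]
        symm
        refine Finset.sum_eq_zero fun r hr => ?_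
        rw [if_neg]
        intro h
        apply hL
        have : (⟨n', hn'⟩ : ↥(oppositeCellRadical (K := F) c)) = r * (r⁻¹ * ⟨n', hn'⟩) := by group
        rw [this]
        exact L'.mul_mem (hR.mem_of_mem r hr) (hK'L' h)
    · have hg' : g ∈ cellLT (K := F) c Fin.revPerm := by
        have := Set.eq_univ_iff_forall.1 (cellLT_rev_union (K := F) c hc) g
        exact this.resolve_right hg
      rw [hf g hg']
      symm
      refine Finset.sum_eq_zero fun r _ => ?_
      simp only [hΦr, Representation.toFun_smoothIndRep_apply, toFun_cellSection]
      refine cellSectionFun_of_not_mem hc _ _ fun h => hg ?_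
      exact mem_parabolicDoubleCoset_rev_of_mul_mem h (Subgroup.inv_mem _ (oppositeCellRadical_le c hc r.2))
  -- Step 6: apply `mk`
  have hΦr_mem : ∀ r, Φr r ∈ vanishingOn (standardParabolicGL F c) σ' (cellLT (K := F) c Fin.revPerm) := fun r =>
    smoothIndRep_apply_mem_vanishingOn (fun g hg => by
      have := mul_mem_cellsBelow c hg (⟨(r : GL (Fin n) F), oppositeCellRadical_le c hc r.2⟩⁻¹ : ↥(upperUnitriangular (Fin n) F))
      exact this) (cellSection_mem_vanishingOn σ' hc hσ' (conjSubgroup (hrP' r) K') (isOpen_conjSubgroup _ hK'o)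
        (isCompact_conjSubgroup _ hK'c) (f.toFun (permGL Fin.revPerm * (r : GL (Fin n) F))))
  have hsub : (⟨f, hf⟩ : ↥(openCellSubrep c σ' ψ).toSubmodule) = ∑ r ∈ R, ⟨Φr r, hΦr_mem r⟩ := by
    apply Subtype.ext
    rw [Submodule.coe_sum]
    exact hdecomp
  rw [hsub, map_sum]
  refine Submodule.sum_mem _ fun r _ => ?_
  -- `[r⁻¹ · Φ] = ψ_U(r⁻¹) [Φ]` and `[Φ_{r K' r⁻¹, ·}] ∈ ℂ [Φ_{K₀, ·}]`
  have hr : (⟨Φr r, hΦr_mem r⟩ : ↥(openCellSubrep c σ' ψ).toSubmodule) =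
      ⟨Representation.smoothIndRep (standardParabolicGL F c) σ'
        ((⟨(r : GL (Fin n) F), oppositeCellRadical_le c hc r.2⟩⁻¹ : ↥(upperUnitriangular (Fin n) F)) : GL (Fin n) F)
        (⟨cellSection σ' hc hσ' (conjSubgroup (hrP' r) K') (isOpen_conjSubgroup _ hK'o) (isCompact_conjSubgroup _ hK'c)
          (f.toFun (permGL Fin.revPerm * (r : GL (Fin n) F))),
          cellSection_mem_vanishingOn σ' hc hσ' (conjSubgroup (hrP' r) K') (isOpen_conjSubgroup _ hK'o) (isCompact_conjSubgroup _ hK'c) (f.toFun (permGL Fin.revPerm * (r : GL (Fin n) F)))⟩ :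
            ↥(openCellSubrep c σ' ψ).toSubmodule),
        smoothIndRep_apply_mem_vanishingOn (fun g hg => mul_mem_cellsBelow c hg _)
          (cellSection_mem_vanishingOn σ' hc hσ' (conjSubgroup (hrP' r) K') (isOpen_conjSubgroup _ hK'o) (isCompact_conjSubgroup _ hK'c) (f.toFun (permGL Fin.revPerm * (r : GL (Fin n) F))))⟩ := rfl
  rw [hr, mk_smoothIndRep_apply]
  refine Submodule.smul_mem _ _ ?_
  refine Submodule.span_mono ?_ (mk_cellSection_mem_span_singleton ψ hc hσ' K₀ hK₀o hK₀c hK₀θ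
    (conjSubgroup (hrP' r) K') (isOpen_conjSubgroup _ hK'o) (isCompact_conjSubgroup _ hK'c)
    (f.toFun (permGL Fin.revPerm * (r : GL (Fin n) F))))
  rintro _ rfl
  exact ⟨_, rfl⟩

end Surjective

end Literature.NumberTheory.Automorphic
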